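import Summits.Langlands.Langlands.Theorems.PhantomRMYoshidaResiduallyYoshidaLiftingCrossLevelRaisingSeedParts
import Summits.Langlands.Langlands.Theorems.PhantomRMYoshidaResiduallyYoshidaLiftingSuccessiveApproximationOfTarget
import HarnessLib

/-!
# Route `PhantomRMYoshida`, crux `ResiduallyYoshidaLifting` (stmt-Langlands-13639), line
# `cross-regular-annihilator-primes`: the lever S4 `stub_crossTypePatching` measured against the route target

S4 (the line's lever: integral `R_𝒮(N) = T_𝒮(N)` with the ×-type local condition at the auxiliary primes, read
as a Hecke-span congruence `CrossFamily … Q N ρ`) is an OPEN statement (patching at a residually-Yoshida `𝔪` in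
weight (2,2) is not in print).  This file records, kernel-checked, how much of it is risk BEYOND the route's own
target `PhantomRMSector`: modulo the target, S4 is at most LEVEL RAISING mod `p^N` to ×-type at `≥ 2` admissible
cross-congruent places FOR AN AUTOMORPHIC MEMBER (`stub_crossTypePatching_of_target_and_levelRaisingModPN`; the
second hypothesis is spelled out inline — it is the Khare–Thorne "raising the level modulo `p^N`" statement,
Thorne2016 §4.8, transplanted to ×-type on `GL₄`, itself open in weight (2,2) but strictly weaker than `R = T`).
In particular the level-raising SEED of the registered S4 (its hypothesis `∃ π₁ ρ₁, …` coming from S3) is idle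
as soon as `ρ` is automorphic: the automorphic `ρ` is its own seed (`member_of_aut`, landed with the S3 parts).

Consequences for the line's census (lead, 2026-08-16): unlike the levers of lines A and B (whose content is
Λ-adic pro-automorphy `EveryShIsLimit` / `ProAut`, statement-equivalent to the crux on its fibres), S4 does NOT
contain the crux: S4 + S5a (Mazur's principle mod `p^N`) + S5b/S5c (limit, landed / Harish-Chandra) give `Aut ρ`,
and none of S3, S4, S5a alone does.  Nothing here is asserted: both hypotheses are named, open statements.

References: J. Thorne, Math. Ann. 364 (2016) [Thorne2016, §4.8 Lemma 4.11–4.12 (raising the level mod p^N),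
Prop. 4.16, Cor. 4.15]; C. Khare, "Modularity of p-adic Galois representations via p-adic approximations",
J. Théor. Nombres Bordeaux 16 (2004) (the method).
-/

noncomputable section

-- `Summit.Langlands.Langlands.…` (summit = sub-problem name, D-0017 layout) trips `dupNamespace` on every decl.
set_option linter.dupNamespace false

open scoped Matrix Classical
open Filter

namespace Summit.Langlands.Langlands.Cruxes.ResiduallyYoshidaLifting.CrossRegularAnnihilatorPrimes

/-- **S4 ≤ route target + level raising mod `p^N`.**  The registered lever `stub_crossTypePatching` (S4 of line
`cross-regular-annihilator-primes`, seeded form) follows from the route target `PhantomRMSector` together with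
level raising mod `p^N` to ×-type for an automorphic MEMBER (second hypothesis, inline): the target makes `ρ`
automorphic (oddness of `σ̄, σ̄'` from `DetCond`, `isOdd_of_detCond`), `member_of_aut` makes `(π, ρ)` a member at
every level `𝔫_ρ · M`, and with `𝔫₁ := 𝔫_ρ · 𝔫₀`, `T₁ := T_ρ` the level-raising hypothesis yields the ×-family at
every depth `N` and admissible `Q` — the seed `(π₁, ρ₁)` offered by S3 is not used.
[cite: Thorne2016, §4.8 (raising the level modulo p^N) and Prop. 4.16] -/
theorem stub_crossTypePatching_of_target_and_levelRaisingModPN :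
    Summit.Langlands.Langlands.Theses.PhantomRMYoshida.PhantomRMSector → (∀ (p : ℕ) [Fact p.Prime], p ≠ 2 → ∀ (k : Type) [Field k] [CharP k p] [IsAlgClosed k] [TopologicalSpace k] [DiscreteTopology k] (red : Valued.integer (PadicAlgCl p) →+* k) (σ σ' : Literature.NumberTheory.GaloisRepresentations.FramedGaloisRep ℚ k 2) (hcpt : Literature.NumberTheory.Automorphic.isCompact_glFiniteIntegralLevel 4 ℚ) (ι : PadicAlgCl p ≃+* ℂ) (𝔫 : Ideal (NumberField.RingOfIntegers ℚ)) (T : Literature.NumberTheory.Automorphic.InfinityType ℚ 4) (π : Literature.NumberTheory.Automorphic.CuspidalAutomorphicRepData 4 ℚ hcpt) (ρ : Literature.NumberTheory.GaloisRepresentations.FramedGaloisRep ℚ (PadicAlgCl p) 4), σ.toGaloisRep.IsIrreducible → σ'.toGaloisRep.IsIrreducible → Summit.Langlands.Langlands.Cruxes.ResiduallyYoshidaLifting.CrossRegularAnnihilatorPrimes.DetCond p σ σ' → (¬ ∃ g : GL (Fin 2) k, ∀ x, g * σ x * g⁻¹ = σ' x) → 𝔫 ≠ 0 → Summit.Langlands.Langlands.Cruxes.ResiduallyYoshidaLifting.CrossRegularAnnihilatorPrimes.Member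 σ σ' red ι 𝔫 T π ρ → ∀ (N : ℕ) (Q : Finset (IsDedekindDomain.HeightOneSpectrum (NumberField.RingOfIntegers ℚ))), (∀ v ∈ Q, Summit.Langlands.Langlands.Cruxes.ResiduallyYoshidaLifting.CrossRegularAnnihilatorPrimes.QGood σ σ' red 𝔫 ρ N v) → 2 ≤ Q.card → Summit.Langlands.Langlands.Cruxes.ResiduallyYoshidaLifting.CrossRegularAnnihilatorPrimes.CrossFamily σ σ' red hcpt ι 𝔫 T Q N ρ) → (∀ (p : ℕ) [Fact p.Prime], p ≠ 2 → ∀ (k : Type) [Field k] [CharP k p] [IsAlgClosed k] [TopologicalSpace k] [DiscreteTopology k] (red : Valued.integer (PadicAlgCl p) →+* k) (σ σ' : Literature.NumberTheory.GaloisRepresentations.FramedGaloisRep ℚ k 2) (hcpt : Literature.NumberTheory.Automorphic.isCompact_glFiniteIntegralLevel 4 ℚ) (ι : PadicAlgCl p ≃+* ℂ) (ρ : Literature.NumberTheory.GaloisRepresentations.FramedGaloisRep ℚ (PadicAlgCl p) 4), σ.toGaloisRep.IsIrreducible → σ'.toGaloisRep.IsIrreducible → Summit.Langlands.Langlands.Cruxes.ResiduallyYoshidaLifting.CrossRegularAnnihilatorPrimes.DetCond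 p σ σ' → (¬ ∃ g : GL (Fin 2) k, ∀ x, g * σ x * g⁻¹ = σ' x) → ρ.toGaloisRep.IsIrreducible → Summit.Langlands.Langlands.Cruxes.ResiduallyYoshidaLifting.CrossRegularAnnihilatorPrimes.Sh σ σ' red ρ → ∀ (𝔫₀ : Ideal (NumberField.RingOfIntegers ℚ)) (T₀ : Literature.NumberTheory.Automorphic.InfinityType ℚ 4), 𝔫₀ ≠ 0 → ∃ (𝔫₁ : Ideal (NumberField.RingOfIntegers ℚ)) (T₁ : Literature.NumberTheory.Automorphic.InfinityType ℚ 4), 𝔫₁ ≠ 0 ∧ ∀ (N : ℕ) (Q : Finset (IsDedekindDomain.HeightOneSpectrum (NumberField.RingOfIntegers ℚ))), (∀ v ∈ Q, Summit.Langlands.Langlands.Cruxes.ResiduallyYoshidaLifting.CrossRegularAnnihilatorPrimes.QGood σ σ' red 𝔫₁ ρ N v) → 2 ≤ Q.card → (∃ (π₁ : Literature.NumberTheory.Automorphic.CuspidalAutomorphicRepData 4 ℚ hcpt) (ρ₁ : Literature.NumberTheory.GaloisRepresentations.FramedGaloisRep ℚ (PadicAlgCl p) 4), (∀ v ∈ Q,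 ¬ (v.asIdeal ∣ 𝔫₀)) ∧ Summit.Langlands.Langlands.Cruxes.ResiduallyYoshidaLifting.CrossRegularAnnihilatorPrimes.Member σ σ' red ι (𝔫₀ * Q.prod (fun v => v.asIdeal ^ 2)) T₀ π₁ ρ₁ ∧ ∀ v ∈ Q, Summit.Langlands.Langlands.Cruxes.ResiduallyYoshidaLifting.CrossRegularAnnihilatorPrimes.CrossType v ρ₁) → Summit.Langlands.Langlands.Cruxes.ResiduallyYoshidaLifting.CrossRegularAnnihilatorPrimes.CrossFamily σ σ' red hcpt ι 𝔫₁ T₁ Q N ρ) := by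
  intro hT hLR p _ hp k _ _ _ _ _ red σ σ' hcpt ι ρ hirr hirr' hdet hnc hirrρ hSh 𝔫₀ _T₀ h𝔫₀
  have hAut : Aut hcpt ι ρ :=
    hT p hp k red σ σ' hcpt ι ρ (isOdd_of_detCond hdet).1 (isOdd_of_detCond hdet).2 hirr hirr' hdet hnc
      hirrρ hSh
  obtain ⟨𝔫ρ, Tρ, π, h𝔫ρ, hM⟩ := member_of_aut red σ σ' hcpt ι ρ hirrρ hSh hAut
  refine ⟨𝔫ρ * 𝔫₀, Tρ, mul_ne_zero h𝔫ρ h𝔫₀, fun N Q hQ hcard _hseed => ?_⟩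
  exact hLR p hp k red σ σ' hcpt ι (𝔫ρ * 𝔫₀) Tρ π ρ hirr hirr' hdet hnc (mul_ne_zero h𝔫ρ h𝔫₀) (hM 𝔫₀ h𝔫₀)
    N Q hQ hcard

end Summit.Langlands.Langlands.Cruxes.ResiduallyYoshidaLifting.CrossRegularAnnihilatorPrimes

end
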